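import Summits.QuantumFields.YangMills.Theorems.BalabanUVNodesN11BgRowGaugeLiftOfPowM
import Literature.MathematicalPhysics.QuantumFieldTheory.Balaban1983to89.Node00.Record13LettersOfThm1CCMW
import Literature.MathematicalPhysics.QuantumFieldTheory.Balaban1983to89.Node00.Record13LettersOfThm1CCMWZ

/-!
# DAG node N11 × K1 — THE GUARD-FREE ROW P11 ROAD OVER THE GUARDED `(Adm, bd, Dat)` [15] SENTENCES WITH A GENERIC STAGE-13 BACKGROUND: witness-agnostic sockets, the witness of
# record `θ₁₅ᶜᶜᴹᵂ(j; γ)` and the z-witness `θ₁₅ᶜᶜᴹᵂᶻ(j; γ; Efl, logz)` — the Stage-2 SEAM displayed as ONE hypothesis `hseam`, the (7) data transfer as ONE hypothesis `hDat`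

HEADER — WORK-UNIT METADATA.  Cell `pub-ymgap`, YM-PLAN Track A (D-0062 ∕ D-0149 ∕ D-0154 width seats), seat `pub-ymgap-dag-n11-w1` (g6; WIDTH SEAT 1 on NODE n11 [B14]; Stage-2
train WORKPLAN-IIIB (iii-b), director-ym №343 (D5)∕(D6), №346 (3), №348 (C): TRAIN-N11 CLASS-T items (7)(b) · (8) · (10) assigned to this seat; R455 (A) CLAIM cell INBOX l.33125),
route `BalabanUVNodes`, key `--kind proof --supports stmt-QuantumFields-20541 --as helper` (K0⁷ helper lane, count-neutral).  [III] = [Balaban1988Convergent], [I] = [Balaban1987RG1],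
[15] = [Balaban1985Variational], [6] = [Balaban1985RegularSpaces], [II] = [Balaban1984PropagatorsII], [IV] = [Balaban1989LargeFieldI].  Over dag-n11-d g41's v1.1 §7 of
`…N11BgRowGaugeROfHcubeOmega` ✓p767169 (★★ `stage13_bgAtDatumBg_of_thm1RegSepCoP7MGB_of_thm1GaugeGB_of_hcubeΩ` — the `(Adm, bd, Dat)`-generic, BACKGROUND-generic Stage-13 lift on the
`hcubeΩ` road), dag-n11-w4's `…N11BgRowOfPowM` (★ `hcubeΩ_of_powM`), node00-def-K0a ∕ dag-n21-c's `Node00/Record13LettersOfThm1CCMW` and DEF-1's `Node00/Record13LettersOfThm1CCMWZ` (the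
witness letters), S1a-C `Node00/Record12BgRowCoClassCPMFloorB` (`VariationalThm1RegSepCoP7MGB`), S1b-2 `Node00/Record12BgRowCoClassGaugeRGuardedB` (`VariationalThm1GaugeRegSepCoP7MGB`).

EDITION v1.1 (dag-n11-w1 g6; director-ym №365 RENAME-AND-REDIRECT; CLASS S — all six statements byte-identical): the lift is now read in its powM form from the NEW module
`…N11BgRowGaugeLiftOfPowM` (§3 `stage13_bgAtDatumBg_of_thm1RegSepCoP7MGB_of_thm1GaugeGB_of_powM`) instead of `…N11BgRowGaugeROfHcubeOmega` §7.3 (that module is RESIDUE after the seam edit);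
the CCMW letters are imported explicitly (`Node00/Record13LettersOfThm1CCMW`); §1a's proof loses its `hcubeΩ_of_powM` line (now inside the lift); nothing else changed.  The LOCATED sentence
on the (7) data transfer below is SUPERSEDED by `…N11BgRowGaugeSocketsGBPrint` ✓p767961 (the transfer to print's clause IS available on this road, guard-free).

WHY THIS FILE (pre-campaign, ADDITIVE, green before AND after the seam edit).  The five witness-level files of the guard-free row-P11 road — `…GaugeROfHcubeOmega` §5∕§6,
`…GaugeRAtWitnessOfPowM` §2∕§3, `…GaugeGOfHcubeOmega` §4–§6, `…GaugeSocketsOfPowM` §1–§4, `…BgRowAtZWitnessOfPowM` §1–§4 — read the Stage-2 seam at exactly ONE token each,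
`rw [UbgOfRecord₁₃CoP_succ]`, after which they key on the (b) sentences over node00-def-R's (b)-datum background `UbgMSCoPOfRecord`.  After the seam edit (`UbgOfRecord₁₃CoP (n+1) :=
UbgMSCoPOfRecordB …`, [II] (2.3) datum `lamBondsSeq`) those record-level rows must be RE-KEYED (CLASS T: hypotheses re-typed to the ᴮ sentences).  This file types the re-keyed road
ONCE, witness-agnostically and for BOTH backgrounds: the background map is a PARAMETER `Ubg` with its per-prefix `bd`-spec dichotomy `hbg` (k0-s1-w1's `…GaugeRGuardedBRow` pattern)
and the seam is the displayed hypothesis `hseam : ∀ p n, UbgOfRecord₁₃CoP F N θ p (n+1) = Ubg p (n+1)` — TODAY inhabited at `(Ubg, bd, hbg, hseam) := (UbgMSCoPOfRecord, genSetDatum F,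
ubgMSCoPOfRecord_dichotomy_genSetDatum, UbgOfRecord₁₃CoP_succ)`, AFTER the seam edit at `(UbgMSCoPOfRecordB, lamDatum F, ubgMSCoPOfRecordB_dichotomy, UbgOfRecord₁₃CoP_succ)` — so
every campaign re-key of the five files is ONE application of a theorem below (k0-s1-w1 g9's `…K0AllTorusOfStepTokensGuardedZBLam` device, on the `hcubeΩ` road).  The (7) data
clause is a PARAMETER `Dat : TopData F N`; where a conclusion reads the support of record `suppOfRecord₁₃SepCoP` (whose third conjunct is the (b) clause `Sect2.DataSmall7PTop`) the
pointwise transfer `hDat` (window-indexed, NO `PartCompat₁₃`) is displayed — `id` at `Dat := dataSmall7PTopOf F N`; at print's `dataSmall7LamTopOf F N` the transfer needs block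
saturation of the regions (`Sect2.DataSmall7PTop.toLamTop`'s `hsat`, i.e. the grid compatibility of the run), which this guard-free road does not have below the coupling floor —
LOCATED, displayed, not asserted.

WHAT THIS FILE PROVES (6 theorems, 0 `def`, 0 `sorry`; compositions BY NAME; every [15] sentence, the seam `hseam`, the transfer `hDat`, the guard row `hadm` are HYPOTHESES).
§1 ★★★ `bgSepCoPAt_of_thm1RegSepCoP7MGB_of_thm1GaugeGB_of_hseam_of_powM` — the WITNESS-AGNOSTIC socket: for any admissible `θ` with `θ.Rz = RzOfRecord`, `θ.τ9.M = L^a`, the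
   window-run-indexed (C1) letter, the no-wrap letter `hsN`, the numeric rows, ANY guard `Adm` met on the window prefixes, ANY background `Ubg` with `hbg` ∧ `hseam`: the (7)-guarded
   separated row-P11 body at `UbgOfRecord₁₃CoP F N θ p n s 𝐖` on EVERY window run, data antecedent `Dat …` — NO `PartCompat₁₃`, NO `hcube` (discharged by `hcubeΩ_of_powM`).
   ★★★ `bgProvisoΛ_of_thm1RegSepCoP7MGB_of_thm1GaugeGB_of_hseam_of_powM` — the same in def-R's currency `BgProvisoΛ … (suppOfRecord₁₃SepCoP …) (UbgOfRecord₁₃CoP …)` given `hDat`.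
§2 ★★★ `bgSepCoPAt_theta13OfThm1CCMW_of_thm1RegSepCoP7MGB_of_thm1GaugeGB_of_hseam_of_hjm` ∕ ★★★ `bgProvisoΛ_theta13OfThm1CCMW_of_thm1RegSepCoP7MGB_of_thm1GaugeGB_of_hseam_of_hjm` — §1 at
   K1's witness of record `θ₁₅ᶜᶜᴹᵂ(j; γ)` on a non-wrapping family `j + 1 ≤ F.m` (letters `Record13LettersOfThm1CCMW`): the campaign TYPES of `…GaugeROfHcubeOmega` §5∕§6 (with
   `hcube` discharged), `…GaugeRAtWitnessOfPowM` §2∕§3 and `…GaugeGOfHcubeOmega` §4∕§5 modulo the instantiation `(Ubg, bd, hbg, hseam)`; the R road is `Adm := floorGuard F c`.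
§3 ★★★ `bgSepCoPAt_theta13OfThm1CCMWZ_of_thm1RegSepCoP7MGB_of_thm1GaugeGB_of_hseam_of_hjm` ∕ ★★★ `bgProvisoΛ_theta13OfThm1CCMWZ_…` — §1 at the z-witness `θ₁₅ᶜᶜᴹᵂᶻ(j; γ; Efl, logz)`
   (DEF-1's Z2 letters `Record13LettersOfThm1CCMWZ`): the campaign TYPES of `…BgRowAtZWitnessOfPowM` §1–§3 modulo the same instantiation.

HONEST FRAMING.  Helper lane (K0⁷ key; N11 [B14] × K1 road); count-neutral HYPOTHESIS THREADING over landed theorems; the ᴮ [15] sentences (8) `VariationalThm1RegSepCoP7MGB` and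
(9) `VariationalThm1GaugeRegSepCoP7MGB` are `Prop`s with parameters, NEVER asserted; `hseam` is NOT provable at the ᴮ background before node00-def-R's seam edit and is NOT claimed;
`hDat`, `hadm`, (hcomp) ∧ (hcompRev), the window `0 < γ ≤ ½`, the six signs, `hjm : j + 1 ≤ F.m` are DISPLAYED.  Nothing in the tree is edited; the (b) road's theorems stay landed
and true on their own text until the seam edit, when the five files above re-key onto this one (CLASS T, same decl names, director-ym №343 (D5)).  NOT a discharge of row P11;
`Provisos₁₃SepCoPH.bg`'s type untouched; N11 ∕ N07 NOT discharged; K0⁷ stub 1 NOT closed; counts unmoved (typed 28∕28 · discharged 8∕27).  R4 closes only the conditional finite-𝕋⁴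
rung `BalabanLadder.UV` of one programme at fixed `ε = L^{−K}` — NOT ℝ⁴, NOT OS, NOT a mass gap; the Yang–Mills mass gap (Clay) is NOT proved by any of this.  No `sorry`, `axiom`,
`def`, `instance`, `notation`.
Sources (SHAPE ∕ bookkeeping only): [III] (2.1) p.254, (2.4)–(2.8) pp.255–256, (2.12)–(2.13) pp.256–257, (2.18) p.257, (2.27)–(2.28) p.259, (2.34)–(2.41) p.261, Thm 1 p.262;
[I] (0.1) p.251, Thm 1 p.259, (1.11)–(1.16) p.262; [15] (6)–(7) p.278, Thm 1 (8)–(9) p.279, (144)–(152) pp.300–301, Prop. 8 p.304, p.304 lines 1–2; [6] (1.3)–(1.9) p.77;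
[II] (2.3) p.224; [IV] (0.3) p.176.
-/

noncomputable section

open MeasureTheory
open scoped Matrix.Norms.L2Operator

namespace Summit.QuantumFields.YangMills.Theorems.BalabanUVNodesN11BgRowGaugeSocketsGB

open Literature.MathematicalPhysics.QuantumFieldTheory.Balaban1983to89 Node00
open T4Continuum B14.Eq218Concrete B15DeterminingSets B15DeterminingSetsB FlowStep FlowStepRuns B12RegularSpaces111 B14RegularSpaces234 B14Radii T4AxialGaugeSmallField
open BalabanUVNodesN11BgRowGaugeLiftOfPowM (stage13_bgAtDatumBg_of_thm1RegSepCoP7MGB_of_thm1GaugeGB_of_powM)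

variable {F : T4Family} {N : ℕ} [NeZero N]

/-! ## §1  The witness-agnostic sockets over the ᴮ sentences — background `Ubg` a parameter (`hbg`, `hseam`), data clause `Dat` a parameter -/

section Sockets

/-- **§1a ★★★ THE WITNESS-AGNOSTIC SOCKET OVER THE GUARDED `(Adm, bd, Dat)` SENTENCES, BACKGROUND-GENERIC — THE (7)-GUARDED SEPARATED ROW P11 BODY AT def-R's RECORD BACKGROUND
`UbgOfRecord₁₃CoP F N θ p n s 𝐖` ON EVERY WINDOW RUN `(p, n ≤ p.K)`, NO `PartCompat₁₃`, NO `hcube`**: for ANY `θ : Stage13Params F N` admissible with `θ.Rz = RzOfRecord`, the ᴮ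
sentences (8) `VariationalThm1RegSepCoP7MGB F N Adm bd Dat` (S1a-C) and (9) `VariationalThm1GaugeRegSepCoP7MGB F N θ.τ9.M Adm bd Dat` (S1b-2), ANY guard `Adm` met on the window
prefixes (`hadm`), ANY background map `Ubg` entering through its per-prefix `bd`-spec dichotomy `hbg` («`bd`-minimiser over the class of record at `𝐖`, or junk `1`») and the
displayed SEAM `hseam : UbgOfRecord₁₃CoP F N θ p (n+1) = Ubg p (n+1)`, the numeric rows, `hMa : θ.τ9.M = F.L ^ a`, the window-run-indexed (C1) `hC1`, the no-wrap letter `hsN`,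
`0 < θ.ν.M₁`; data antecedent `Dat p.K s.Ω (suppDomOfRecord …) n (c_R ε_·) 𝐖`.  Proof: level `0` vacuous; at level `n + 1`, `hseam` + the powM lift `…LiftOfPowM` §3
`stage13_bgAtDatumBg_of_thm1RegSepCoP7MGB_of_thm1GaugeGB_of_powM` (dag-n11-d's §7.3 with `hcube := hcubeΩ_of_powM …`, dag-n11-w4's «BG-ONEBLOCK» §1).  = `…GaugeSocketsOfPowM` §1∕§3's TYPE over the ᴮ
letters with `Dat` for the (b) data clause.  TODAY `(Ubg, bd, hbg, hseam) := (UbgMSCoPOfRecord, genSetDatum F, ubgMSCoPOfRecord_dichotomy_genSetDatum, UbgOfRecord₁₃CoP_succ)`; AFTER the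
Stage-2 seam edit `(UbgMSCoPOfRecordB, lamDatum F, ubgMSCoPOfRecordB_dichotomy, UbgOfRecord₁₃CoP_succ)`.  CONDITIONAL; a REDUCTION; nothing of Bałaban asserted.
[cite: Balaban1985Variational, (6)–(7) p.278, Thm 1 (8)–(9) p.279, (144)–(152) pp.300–301, Prop. 8 p.304, p.304 lines 1–2; Balaban1985RegularSpaces, (1.3)–(1.9) p.77; Balaban1984PropagatorsII, (2.3) p.224; Balaban1988Convergent, Thm 1 p.262, (2.1) p.254, (2.4)–(2.8) pp.255–256, (2.12)–(2.13) pp.256–257, (2.27)–(2.28) p.259, (2.34)–(2.41) p.261; Balaban1987RG1, (0.1) p.251, Thm 1 p.259, (1.11)–(1.12) p.262] -/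
theorem bgSepCoPAt_of_thm1RegSepCoP7MGB_of_thm1GaugeGB_of_hseam_of_powM (θ : Stage13Params F N) (hθ : θ.Admissible F N) (hRz : θ.Rz = RzOfRecord F N)
    {Adm : StepGuard F} {bd : BondDatum F} {Dat : TopData F N} {a : ℕ} {B₃ B₃' a₀ a₁ : ℝ}
    (h15 : VariationalThm1RegSepCoP7MGB F N Adm bd Dat B₃ a₀ a₁) (h15G : VariationalThm1GaugeRegSepCoP7MGB F N θ.τ9.M Adm bd Dat B₃ B₃' a₀ a₁)
    (Ubg : (p : B12.RunParams) → (n : ℕ) → SeqOfRecord F θ.ν θ.τ9.M (gOfRecord₁₃ F N θ p) p.K n → BgMap F N p.K)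
    (hbg : ∀ (p : B12.RunParams) (n : ℕ) (s : SeqOfRecord F θ.ν θ.τ9.M (gOfRecord₁₃ F N θ p) p.K n) (W : MSField (F.P p.K) (SU N)),
      IsMinimizerB (avOfRecord F N p.K) (regMSCoPOfRecord F N θ.ν p.K n s.Ω) (bd p.K n s.Ω) W (Ubg p n s W) ∨ Ubg p n s W = 1)
    (hseam : ∀ (p : B12.RunParams) (n : ℕ), UbgOfRecord₁₃CoP F N θ p (n + 1) = Ubg p (n + 1))
    (hnum : ∀ (p : B12.RunParams) (n : ℕ), n ≤ p.K → Step.InInterval θ.γ n (gOfRecord₁₃ F N θ p) → ∀ m, m ≤ n →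
      0 < θ.s2.cR * epsOfRecord θ.ν (gOfRecord₁₃ F N θ p) m ∧ θ.s2.cR * epsOfRecord θ.ν (gOfRecord₁₃ F N θ p) m ≤ a₁ ∧ B₃ * (θ.s2.cR * epsOfRecord θ.ν (gOfRecord₁₃ F N θ p) m) ≤ θ.ν.εreg)
    (ha₀ : θ.ν.εreg ≤ a₀)
    (hcomp : ∀ (p : B12.RunParams) (n : ℕ), n ≤ p.K → Step.InInterval θ.γ n (gOfRecord₁₃ F N θ p) → ∀ m, m < n →
      θ.s2.cR * epsOfRecord θ.ν (gOfRecord₁₃ F N θ p) m ≤ 2 * (θ.s2.cR * epsOfRecord θ.ν (gOfRecord₁₃ F N θ p) (m + 1)))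
    (hcomp' : ∀ (p : B12.RunParams) (n : ℕ), n ≤ p.K → Step.InInterval θ.γ n (gOfRecord₁₃ F N θ p) → ∀ m, m < n →
      θ.s2.cR * epsOfRecord θ.ν (gOfRecord₁₃ F N θ p) (m + 1) ≤ 2 * (θ.s2.cR * epsOfRecord θ.ν (gOfRecord₁₃ F N θ p) m))
    (hBα : ∀ (p : B12.RunParams) (n : ℕ), n ≤ p.K → Step.InInterval θ.γ n (gOfRecord₁₃ F N θ p) → ∀ m, 1 ≤ m → m ≤ n →
      B₃ * (θ.s2.cR * epsOfRecord θ.ν (gOfRecord₁₃ F N θ p) m) ≤ (1 - θ.s2.βc) * (lfOfRecord₁₂ F N θ.toStage12Params).alpha0 (gOfRecord₁₃ F N θ p m))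
    (htI : ∀ (p : B12.RunParams) (n : ℕ), n ≤ p.K → Step.InInterval θ.γ n (gOfRecord₁₃ F N θ p) → ∀ m, 1 ≤ m → m ≤ n →
      B₃' * (θ.s2.cR * epsOfRecord θ.ν (gOfRecord₁₃ F N θ p) m) ≤ θ.s2.cB * (lfOfRecord₁₂ F N θ.toStage12Params).alpha0 (gOfRecord₁₃ F N θ p m))
    (htMS : ∀ (p : B12.RunParams) (n : ℕ), n ≤ p.K → Step.InInterval θ.γ n (gOfRecord₁₃ F N θ p) → ∀ m, 1 ≤ m → m ≤ n →
      B₃' * (θ.s2.cR * epsOfRecord θ.ν (gOfRecord₁₃ F N θ p) m) ≤ θ.s2.B * θ.s2.C * θ.s2.Mr * (lfOfRecord₁₂ F N θ.toStage12Params).alpha0 (gOfRecord₁₃ F N θ p m))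
    (hsN : ∀ (p : B12.RunParams) (n : ℕ), n ≤ p.K → ∀ n', 1 ≤ n' → n' ≤ n + 1 →
      ((B14.Eq213MaximalDomains.side (F.P p.K).L θ.τ9.M n' : ℕ) : ℤ) < (F.P p.K).sitesPerDir 0)
    (hMa : θ.τ9.M = F.L ^ a)
    (hC1 : ∀ (p : B12.RunParams) (n : ℕ), n ≤ p.K → Step.InInterval θ.γ n (gOfRecord₁₃ F N θ p) → ∀ j, 1 ≤ j → j ≤ n →
      ∃ t : ℕ, 0 < t ∧ RkOfRecord (F.P p.K).L θ.ν.r (gOfRecord₁₃ F N θ p j) = (F.P p.K).L * t)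
    (hM₁ : 0 < θ.ν.M₁)
    (hadm : ∀ (p : B12.RunParams) (n : ℕ), n ≤ p.K → Step.InInterval θ.γ n (gOfRecord₁₃ F N θ p) →
      ∀ s : SeqOfRecord F θ.ν θ.τ9.M (gOfRecord₁₃ F N θ p) p.K n, Adm θ.ν θ.τ9.M (gOfRecord₁₃ F N θ p) p.K n s) :
    ∀ (p : B12.RunParams) (n : ℕ), n ≤ p.K → Step.InInterval θ.γ n (gOfRecord₁₃ F N θ p) →
      ∀ s : SeqOfRecord F θ.ν θ.τ9.M (gOfRecord₁₃ F N θ p) p.K n, Sect2.SeqSeparated θ.ν.M₁ s →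
      ∀ W : MSField (F.P p.K) (SU N), W ∈ suppOfRecord₁₃P F N θ p n s →
      Dat p.K s.Ω (suppDomOfRecord F θ.ν p.K s.Ω) n (fun j' => θ.s2.cR * epsOfRecord θ.ν (gOfRecord₁₃ F N θ p) j') W →
      ∀ j', 1 ≤ j' → j' ≤ n → ∀ X : (Sect2.domSys (F.P p.K) θ.τ9.M j').Dom,
      (Sect2.domSites (F.P p.K) θ.τ9.M j' X ⊆ s.Λ j' →
        Sect2.ofBackgroundC (settingOfRecord₁₃ F N θ p).ι (UbgOfRecord₁₃CoP F N θ p n s W) ∈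
          Sect2.spaceI (settingOfRecord₁₃ F N θ p) (θ.Rz p.K) θ.τ9.M j' (Sect2.domSites (F.P p.K) θ.τ9.M j' X)
            ((settingOfRecord₁₃ F N θ p).lf.alpha0 ((settingOfRecord₁₃ F N θ p).flow.g j')) ((settingOfRecord₁₃ F N θ p).lf.alpha1 ((settingOfRecord₁₃ F N θ p).flow.g j'))) ∧
      (Sect2.admB (F.P p.K) θ.ν θ.τ9.M (gOfRecord₁₃ F N θ p) s.Ω s.Λ j' (Sect2.domSites (F.P p.K) θ.τ9.M j' X) = true →
        Sect2.ofBackgroundC (settingOfRecord₁₃ F N θ p).ι (UbgOfRecord₁₃CoP F N θ p n s W) ∈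
          Sect2.spaceMS (settingOfRecord₁₃ F N θ p) (θ.Rz p.K) θ.τ9.M j' (Sect2.domSites (F.P p.K) θ.τ9.M j' X) s.Ω) := by
  intro p n hn hw s hsep W _ h7
  cases n with
  | zero => intro j' h1 hj'; exfalso; omega
  | succ n =>
    rw [hseam]
    exact stage13_bgAtDatumBg_of_thm1RegSepCoP7MGB_of_thm1GaugeGB_of_powM θ hθ hRz h15 h15G Ubg hbg hnum ha₀ hcomp hcomp' hBα htI htMS hMa hC1 hsN
      p (n + 1) hn hw s hsep hM₁ (hadm p (n + 1) hn hw s) W h7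

/-- **§1b ★★★ THE WITNESS-AGNOSTIC SOCKET IN def-R's CURRENCY OVER THE ᴮ SENTENCES — ROW P11 `BgProvisoΛ F N p.K (settingOfRecord₁₃ F N θ p) (θ.Rz p.K) θ.τ9.M n (suppOfRecord₁₃SepCoP F N θ p n)
(UbgOfRecord₁₃CoP F N θ p n)` ON EVERY WINDOW RUN** (the exact consequent of `Provisos₁₃SepCoPH.bg` with NO `PartCompat₁₃` antecedent; the type of dag-n11-w1's `hbg(s)` binders):
§1a through K0a's support adapter (membership in `suppOfRecord₁₃SepCoP` = ⟨regular support, separation, (b)'s (7)-regularity `Sect2.DataSmall7PTop`⟩) and the displayed window-indexed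
TRANSFER `hDat` from the support's (b) clause to `Dat` (`id` at `Dat := dataSmall7PTopOf F N`; at print's `dataSmall7LamTopOf F N` it is `Sect2.DataSmall7PTop.toLamTop`, which needs the
block saturation of the regions — not available on this guard-free road; LOCATED, displayed).  CONDITIONAL; nothing of Bałaban asserted.
[cite: Balaban1988Convergent, (2.28) p.259, (2.18) p.257, Thm 1 p.262; Balaban1985Variational, (3),(6)–(7) p.278, Thm 1 (8)–(9) p.279, p.304 lines 1–2; Balaban1985RegularSpaces, (1.3)–(1.6) p.77; Balaban1984PropagatorsII, (2.3) p.224; Balaban1987RG1, (0.1) p.251, (1.12) p.262] -/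
theorem bgProvisoΛ_of_thm1RegSepCoP7MGB_of_thm1GaugeGB_of_hseam_of_powM (θ : Stage13Params F N) (hθ : θ.Admissible F N) (hRz : θ.Rz = RzOfRecord F N)
    {Adm : StepGuard F} {bd : BondDatum F} {Dat : TopData F N} {a : ℕ} {B₃ B₃' a₀ a₁ : ℝ}
    (h15 : VariationalThm1RegSepCoP7MGB F N Adm bd Dat B₃ a₀ a₁) (h15G : VariationalThm1GaugeRegSepCoP7MGB F N θ.τ9.M Adm bd Dat B₃ B₃' a₀ a₁)
    (Ubg : (p : B12.RunParams) → (n : ℕ) → SeqOfRecord F θ.ν θ.τ9.M (gOfRecord₁₃ F N θ p) p.K n → BgMap F N p.K)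
    (hbg : ∀ (p : B12.RunParams) (n : ℕ) (s : SeqOfRecord F θ.ν θ.τ9.M (gOfRecord₁₃ F N θ p) p.K n) (W : MSField (F.P p.K) (SU N)),
      IsMinimizerB (avOfRecord F N p.K) (regMSCoPOfRecord F N θ.ν p.K n s.Ω) (bd p.K n s.Ω) W (Ubg p n s W) ∨ Ubg p n s W = 1)
    (hseam : ∀ (p : B12.RunParams) (n : ℕ), UbgOfRecord₁₃CoP F N θ p (n + 1) = Ubg p (n + 1))
    (hnum : ∀ (p : B12.RunParams) (n : ℕ), n ≤ p.K → Step.InInterval θ.γ n (gOfRecord₁₃ F N θ p) → ∀ m, m ≤ n →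
      0 < θ.s2.cR * epsOfRecord θ.ν (gOfRecord₁₃ F N θ p) m ∧ θ.s2.cR * epsOfRecord θ.ν (gOfRecord₁₃ F N θ p) m ≤ a₁ ∧ B₃ * (θ.s2.cR * epsOfRecord θ.ν (gOfRecord₁₃ F N θ p) m) ≤ θ.ν.εreg)
    (ha₀ : θ.ν.εreg ≤ a₀)
    (hcomp : ∀ (p : B12.RunParams) (n : ℕ), n ≤ p.K → Step.InInterval θ.γ n (gOfRecord₁₃ F N θ p) → ∀ m, m < n →
      θ.s2.cR * epsOfRecord θ.ν (gOfRecord₁₃ F N θ p) m ≤ 2 * (θ.s2.cR * epsOfRecord θ.ν (gOfRecord₁₃ F N θ p) (m + 1)))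
    (hcomp' : ∀ (p : B12.RunParams) (n : ℕ), n ≤ p.K → Step.InInterval θ.γ n (gOfRecord₁₃ F N θ p) → ∀ m, m < n →
      θ.s2.cR * epsOfRecord θ.ν (gOfRecord₁₃ F N θ p) (m + 1) ≤ 2 * (θ.s2.cR * epsOfRecord θ.ν (gOfRecord₁₃ F N θ p) m))
    (hBα : ∀ (p : B12.RunParams) (n : ℕ), n ≤ p.K → Step.InInterval θ.γ n (gOfRecord₁₃ F N θ p) → ∀ m, 1 ≤ m → m ≤ n →
      B₃ * (θ.s2.cR * epsOfRecord θ.ν (gOfRecord₁₃ F N θ p) m) ≤ (1 - θ.s2.βc) * (lfOfRecord₁₂ F N θ.toStage12Params).alpha0 (gOfRecord₁₃ F N θ p m))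
    (htI : ∀ (p : B12.RunParams) (n : ℕ), n ≤ p.K → Step.InInterval θ.γ n (gOfRecord₁₃ F N θ p) → ∀ m, 1 ≤ m → m ≤ n →
      B₃' * (θ.s2.cR * epsOfRecord θ.ν (gOfRecord₁₃ F N θ p) m) ≤ θ.s2.cB * (lfOfRecord₁₂ F N θ.toStage12Params).alpha0 (gOfRecord₁₃ F N θ p m))
    (htMS : ∀ (p : B12.RunParams) (n : ℕ), n ≤ p.K → Step.InInterval θ.γ n (gOfRecord₁₃ F N θ p) → ∀ m, 1 ≤ m → m ≤ n →
      B₃' * (θ.s2.cR * epsOfRecord θ.ν (gOfRecord₁₃ F N θ p) m) ≤ θ.s2.B * θ.s2.C * θ.s2.Mr * (lfOfRecord₁₂ F N θ.toStage12Params).alpha0 (gOfRecord₁₃ F N θ p m))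
    (hsN : ∀ (p : B12.RunParams) (n : ℕ), n ≤ p.K → ∀ n', 1 ≤ n' → n' ≤ n + 1 →
      ((B14.Eq213MaximalDomains.side (F.P p.K).L θ.τ9.M n' : ℕ) : ℤ) < (F.P p.K).sitesPerDir 0)
    (hMa : θ.τ9.M = F.L ^ a)
    (hC1 : ∀ (p : B12.RunParams) (n : ℕ), n ≤ p.K → Step.InInterval θ.γ n (gOfRecord₁₃ F N θ p) → ∀ j, 1 ≤ j → j ≤ n →
      ∃ t : ℕ, 0 < t ∧ RkOfRecord (F.P p.K).L θ.ν.r (gOfRecord₁₃ F N θ p j) = (F.P p.K).L * t)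
    (hM₁ : 0 < θ.ν.M₁)
    (hadm : ∀ (p : B12.RunParams) (n : ℕ), n ≤ p.K → Step.InInterval θ.γ n (gOfRecord₁₃ F N θ p) →
      ∀ s : SeqOfRecord F θ.ν θ.τ9.M (gOfRecord₁₃ F N θ p) p.K n, Adm θ.ν θ.τ9.M (gOfRecord₁₃ F N θ p) p.K n s)
    (hDat : ∀ (p : B12.RunParams) (n : ℕ) (s : SeqOfRecord F θ.ν θ.τ9.M (gOfRecord₁₃ F N θ p) p.K n) (δ : ℕ → ℝ) (W : MSField (F.P p.K) (SU N)),
      n ≤ p.K → Step.InInterval θ.γ n (gOfRecord₁₃ F N θ p) →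
      Sect2.DataSmall7PTop (avOfRecord F N p.K) s.Ω (suppDomOfRecord F θ.ν p.K s.Ω) n δ W → Dat p.K s.Ω (suppDomOfRecord F θ.ν p.K s.Ω) n δ W) :
    ∀ (p : B12.RunParams) (n : ℕ), n ≤ p.K → Step.InInterval θ.γ n (gOfRecord₁₃ F N θ p) →
      BgProvisoΛ F N p.K (settingOfRecord₁₃ F N θ p) (θ.Rz p.K) θ.τ9.M n
        (suppOfRecord₁₃SepCoP F N θ p n) (UbgOfRecord₁₃CoP F N θ p n) := by
  intro p n hn hw s W hW
  exact bgSepCoPAt_of_thm1RegSepCoP7MGB_of_thm1GaugeGB_of_hseam_of_powM θ hθ hRz h15 h15G Ubg hbg hseam hnum ha₀ hcomp hcomp' hBα htI htMS hsN hMa hC1 hM₁ hadm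
    p n hn hw s hW.2.1 W hW.1 (hDat p n s _ W hn hw hW.2.2)

end Sockets

/-! ## §2  At K1's WITNESS OF RECORD `θ₁₅ᶜᶜᴹᵂ(j; γ)` — non-wrapping families `j + 1 ≤ F.m`, EVERY window run, NO run guard; the letters of `Record13LettersOfThm1CCMW` -/

section WitnessCCMW

variable {j : ℕ} {γ ε₀ ε₂₉ B₃ B₃' a₀ a₁ : ℝ}

/-- **§2a ★★★ THE (7)-GUARDED SEPARATED ROW P11 BODY AT K1's WITNESS OF RECORD `θ₁₅ᶜᶜᴹᵂ(j; γ)` ON EVERY WINDOW RUN FROM THE ᴮ SENTENCES — ANY GUARD `Adm` MET ON THE WINDOW PREFIXES, ANY BACKGROUND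
`(Ubg, bd)` WITH `hbg` ∧ `hseam`, data antecedent `Dat …`** — §1a at `θ := theta13OfThm1CCMW F N j γ ε₀ ε₂₉ B₃ B₃' a₀ a₁` on a non-wrapping family `j + 1 ≤ F.m`: admissibility from `0 < γ ≤ ½` and the six signs, `Rz` by
`rfl`, the numeric rows, `τ9.M = L^j`, (C1) on the window runs, the no-wrap letter from `hjm`, `0 < M₁` — all BY NAME from `Record13LettersOfThm1CCMW`.  The campaign re-keys of `…GaugeROfHcubeOmega` §5 (with `hcube` discharged), `…GaugeRAtWitnessOfPowM` §2, `…GaugeGOfHcubeOmega` §4 ∕ §6a at this witness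
are this theorem at `(Ubg, bd, hbg, hseam) := (UbgMSCoPOfRecordB, lamDatum F, ubgMSCoPOfRecordB_dichotomy, UbgOfRecord₁₃CoP_succ)` (R road: `Adm := floorGuard F c`, `hadm` from
`c ≤ L^j = ν.M₁`).  CONDITIONAL; nothing of Bałaban asserted.
[cite: Balaban1985Variational, (6)–(7) p.278, Thm 1 (8)–(9) p.279, (144)–(152) pp.300–301, Prop. 8 p.304, p.304 lines 1–2; Balaban1985RegularSpaces, (1.3)–(1.9) p.77; Balaban1984PropagatorsII, (2.3) p.224; Balaban1988Convergent, Thm 1 p.262, (2.1) p.254, (2.4)–(2.8) pp.255–256, (2.12)–(2.13) pp.256–257, (2.28) p.259, p.257; Balaban1987RG1, (0.1) p.251, Thm 1 p.259, (1.12) p.262] -/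
theorem bgSepCoPAt_theta13OfThm1CCMW_of_thm1RegSepCoP7MGB_of_thm1GaugeGB_of_hseam_of_hjm (hγ0 : 0 < γ) (hγ : γ ≤ 1 / 2) (hjm : j + 1 ≤ F.m) (hε : 0 < ε₀) (hε' : 0 < ε₂₉) (hB : 0 ≤ B₃) (hB' : 0 ≤ B₃')
    (ha₀ : 0 < a₀) (ha₁ : 0 < a₁) {Adm : StepGuard F} {bd : BondDatum F} {Dat : TopData F N}
    (h15 : VariationalThm1RegSepCoP7MGB F N Adm bd Dat B₃ a₀ a₁) (h15G : VariationalThm1GaugeRegSepCoP7MGB F N (F.L ^ j) Adm bd Dat B₃ B₃' a₀ a₁)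
    (Ubg : (p : B12.RunParams) → (n : ℕ) → SeqOfRecord F (theta13OfThm1CCMW F N j γ ε₀ ε₂₉ B₃ B₃' a₀ a₁).ν (theta13OfThm1CCMW F N j γ ε₀ ε₂₉ B₃ B₃' a₀ a₁).τ9.M (gOfRecord₁₃ F N (theta13OfThm1CCMW F N j γ ε₀ ε₂₉ B₃ B₃' a₀ a₁) p) p.K n → BgMap F N p.K)
    (hbg : ∀ (p : B12.RunParams) (n : ℕ) (s : SeqOfRecord F (theta13OfThm1CCMW F N j γ ε₀ ε₂₉ B₃ B₃' a₀ a₁).ν (theta13OfThm1CCMW F N j γ ε₀ ε₂₉ B₃ B₃' a₀ a₁).τ9.M (gOfRecord₁₃ F N (theta13OfThm1CCMW F N j γ ε₀ ε₂₉ B₃ B₃' a₀ a₁) p) p.K n) (W : MSField (F.P p.K) (SU N)),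
      IsMinimizerB (avOfRecord F N p.K) (regMSCoPOfRecord F N (theta13OfThm1CCMW F N j γ ε₀ ε₂₉ B₃ B₃' a₀ a₁).ν p.K n s.Ω) (bd p.K n s.Ω) W (Ubg p n s W) ∨ Ubg p n s W = 1)
    (hseam : ∀ (p : B12.RunParams) (n : ℕ), UbgOfRecord₁₃CoP F N (theta13OfThm1CCMW F N j γ ε₀ ε₂₉ B₃ B₃' a₀ a₁) p (n + 1) = Ubg p (n + 1))
    (hadm : ∀ (p : B12.RunParams) (n : ℕ), n ≤ p.K → Step.InInterval (theta13OfThm1CCMW F N j γ ε₀ ε₂₉ B₃ B₃' a₀ a₁).γ n (gOfRecord₁₃ F N (theta13OfThm1CCMW F N j γ ε₀ ε₂₉ B₃ B₃' a₀ a₁) p) →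
      ∀ s : SeqOfRecord F (theta13OfThm1CCMW F N j γ ε₀ ε₂₉ B₃ B₃' a₀ a₁).ν (theta13OfThm1CCMW F N j γ ε₀ ε₂₉ B₃ B₃' a₀ a₁).τ9.M (gOfRecord₁₃ F N (theta13OfThm1CCMW F N j γ ε₀ ε₂₉ B₃ B₃' a₀ a₁) p) p.K n, Adm (theta13OfThm1CCMW F N j γ ε₀ ε₂₉ B₃ B₃' a₀ a₁).ν (theta13OfThm1CCMW F N j γ ε₀ ε₂₉ B₃ B₃' a₀ a₁).τ9.M (gOfRecord₁₃ F N (theta13OfThm1CCMW F N j γ ε₀ ε₂₉ B₃ B₃' a₀ a₁) p) p.K n s)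
    (hcomp : ∀ (p : B12.RunParams) (n : ℕ), n ≤ p.K → Step.InInterval (theta13OfThm1CCMW F N j γ ε₀ ε₂₉ B₃ B₃' a₀ a₁).γ n (gOfRecord₁₃ F N (theta13OfThm1CCMW F N j γ ε₀ ε₂₉ B₃ B₃' a₀ a₁) p) → ∀ m, m < n →
      (theta13OfThm1CCMW F N j γ ε₀ ε₂₉ B₃ B₃' a₀ a₁).s2.cR * epsOfRecord (theta13OfThm1CCMW F N j γ ε₀ ε₂₉ B₃ B₃' a₀ a₁).ν (gOfRecord₁₃ F N (theta13OfThm1CCMW F N j γ ε₀ ε₂₉ B₃ B₃' a₀ a₁) p) m ≤ 2 * ((theta13OfThm1CCMW F N j γ ε₀ ε₂₉ B₃ B₃' a₀ a₁).s2.cR * epsOfRecord (theta13OfThm1CCMW F N j γ ε₀ ε₂₉ B₃ B₃' a₀ a₁).ν (gOfRecord₁₃ F N (theta13OfThm1CCMW F N j γ ε₀ ε₂₉ B₃ B₃' a₀ a₁) p) (m + 1)))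
    (hcompRev : ∀ (p : B12.RunParams) (n : ℕ), n ≤ p.K → Step.InInterval (theta13OfThm1CCMW F N j γ ε₀ ε₂₉ B₃ B₃' a₀ a₁).γ n (gOfRecord₁₃ F N (theta13OfThm1CCMW F N j γ ε₀ ε₂₉ B₃ B₃' a₀ a₁) p) → ∀ m, m < n →
      (theta13OfThm1CCMW F N j γ ε₀ ε₂₉ B₃ B₃' a₀ a₁).s2.cR * epsOfRecord (theta13OfThm1CCMW F N j γ ε₀ ε₂₉ B₃ B₃' a₀ a₁).ν (gOfRecord₁₃ F N (theta13OfThm1CCMW F N j γ ε₀ ε₂₉ B₃ B₃' a₀ a₁) p) (m + 1) ≤ 2 * ((theta13OfThm1CCMW F N j γ ε₀ ε₂₉ B₃ B₃' a₀ a₁).s2.cR * epsOfRecord (theta13OfThm1CCMW F N j γ ε₀ ε₂₉ B₃ B₃' a₀ a₁).ν (gOfRecord₁₃ F N (theta13OfThm1CCMW F N j γ ε₀ ε₂₉ B₃ B₃' a₀ a₁) p) m)) :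
    ∀ (p : B12.RunParams) (n : ℕ), n ≤ p.K → Step.InInterval (theta13OfThm1CCMW F N j γ ε₀ ε₂₉ B₃ B₃' a₀ a₁).γ n (gOfRecord₁₃ F N (theta13OfThm1CCMW F N j γ ε₀ ε₂₉ B₃ B₃' a₀ a₁) p) →
      ∀ s : SeqOfRecord F (theta13OfThm1CCMW F N j γ ε₀ ε₂₉ B₃ B₃' a₀ a₁).ν (theta13OfThm1CCMW F N j γ ε₀ ε₂₉ B₃ B₃' a₀ a₁).τ9.M (gOfRecord₁₃ F N (theta13OfThm1CCMW F N j γ ε₀ ε₂₉ B₃ B₃' a₀ a₁) p) p.K n, Sect2.SeqSeparated (theta13OfThm1CCMW F N j γ ε₀ ε₂₉ B₃ B₃' a₀ a₁).ν.M₁ s →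
      ∀ W : MSField (F.P p.K) (SU N), W ∈ suppOfRecord₁₃P F N (theta13OfThm1CCMW F N j γ ε₀ ε₂₉ B₃ B₃' a₀ a₁) p n s →
      Dat p.K s.Ω (suppDomOfRecord F (theta13OfThm1CCMW F N j γ ε₀ ε₂₉ B₃ B₃' a₀ a₁).ν p.K s.Ω) n (fun j' => (theta13OfThm1CCMW F N j γ ε₀ ε₂₉ B₃ B₃' a₀ a₁).s2.cR * epsOfRecord (theta13OfThm1CCMW F N j γ ε₀ ε₂₉ B₃ B₃' a₀ a₁).ν (gOfRecord₁₃ F N (theta13OfThm1CCMW F N j γ ε₀ ε₂₉ B₃ B₃' a₀ a₁) p) j') W →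
      ∀ j', 1 ≤ j' → j' ≤ n → ∀ X : (Sect2.domSys (F.P p.K) (theta13OfThm1CCMW F N j γ ε₀ ε₂₉ B₃ B₃' a₀ a₁).τ9.M j').Dom,
      (Sect2.domSites (F.P p.K) (theta13OfThm1CCMW F N j γ ε₀ ε₂₉ B₃ B₃' a₀ a₁).τ9.M j' X ⊆ s.Λ j' →
        Sect2.ofBackgroundC (settingOfRecord₁₃ F N (theta13OfThm1CCMW F N j γ ε₀ ε₂₉ B₃ B₃' a₀ a₁) p).ι (UbgOfRecord₁₃CoP F N (theta13OfThm1CCMW F N j γ ε₀ ε₂₉ B₃ B₃' a₀ a₁) p n s W) ∈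
          Sect2.spaceI (settingOfRecord₁₃ F N (theta13OfThm1CCMW F N j γ ε₀ ε₂₉ B₃ B₃' a₀ a₁) p) ((theta13OfThm1CCMW F N j γ ε₀ ε₂₉ B₃ B₃' a₀ a₁).Rz p.K) (theta13OfThm1CCMW F N j γ ε₀ ε₂₉ B₃ B₃' a₀ a₁).τ9.M j' (Sect2.domSites (F.P p.K) (theta13OfThm1CCMW F N j γ ε₀ ε₂₉ B₃ B₃' a₀ a₁).τ9.M j' X)
            ((settingOfRecord₁₃ F N (theta13OfThm1CCMW F N j γ ε₀ ε₂₉ B₃ B₃' a₀ a₁) p).lf.alpha0 ((settingOfRecord₁₃ F N (theta13OfThm1CCMW F N j γ ε₀ ε₂₉ B₃ B₃' a₀ a₁) p).flow.g j')) ((settingOfRecord₁₃ F N (theta13OfThm1CCMW F N j γ ε₀ ε₂₉ B₃ B₃' a₀ a₁) p).lf.alpha1 ((settingOfRecord₁₃ F N (theta13OfThm1CCMW F N j γ ε₀ ε₂₉ B₃ B₃' a₀ a₁) p).flow.g j'))) ∧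
      (Sect2.admB (F.P p.K) (theta13OfThm1CCMW F N j γ ε₀ ε₂₉ B₃ B₃' a₀ a₁).ν (theta13OfThm1CCMW F N j γ ε₀ ε₂₉ B₃ B₃' a₀ a₁).τ9.M (gOfRecord₁₃ F N (theta13OfThm1CCMW F N j γ ε₀ ε₂₉ B₃ B₃' a₀ a₁) p) s.Ω s.Λ j' (Sect2.domSites (F.P p.K) (theta13OfThm1CCMW F N j γ ε₀ ε₂₉ B₃ B₃' a₀ a₁).τ9.M j' X) = true →
        Sect2.ofBackgroundC (settingOfRecord₁₃ F N (theta13OfThm1CCMW F N j γ ε₀ ε₂₉ B₃ B₃' a₀ a₁) p).ι (UbgOfRecord₁₃CoP F N (theta13OfThm1CCMW F N j γ ε₀ ε₂₉ B₃ B₃' a₀ a₁) p n s W) ∈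
          Sect2.spaceMS (settingOfRecord₁₃ F N (theta13OfThm1CCMW F N j γ ε₀ ε₂₉ B₃ B₃' a₀ a₁) p) ((theta13OfThm1CCMW F N j γ ε₀ ε₂₉ B₃ B₃' a₀ a₁).Rz p.K) (theta13OfThm1CCMW F N j γ ε₀ ε₂₉ B₃ B₃' a₀ a₁).τ9.M j' (Sect2.domSites (F.P p.K) (theta13OfThm1CCMW F N j γ ε₀ ε₂₉ B₃ B₃' a₀ a₁).τ9.M j' X) s.Ω) :=
  bgSepCoPAt_of_thm1RegSepCoP7MGB_of_thm1GaugeGB_of_hseam_of_powM (theta13OfThm1CCMW F N j γ ε₀ ε₂₉ B₃ B₃' a₀ a₁) (admissible_theta13OfThm1CCMW_of_le_half F N hγ0 hγ hε hε' hB hB' ha₀ ha₁) rfl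
    h15 h15G Ubg hbg hseam (hnum_theta13OfThm1CCMW hγ hB hB' ha₀ ha₁) εreg_le_theta13OfThm1CCMW hcomp hcompRev
    (hBα_theta13OfThm1CCMW hγ hB hB' ha₀.le ha₁.le) (htI_theta13OfThm1CCMW hγ hB hB' ha₀.le ha₁.le) (htMS_theta13OfThm1CCMW hγ hB hB' ha₀.le ha₁.le)
    (hsN_theta13OfThm1CCMW F N γ ε₀ ε₂₉ B₃ B₃' a₀ a₁ hjm) (theta13OfThm1CCMW_τ9_M F N j γ ε₀ ε₂₉ B₃ B₃' a₀ a₁) (hC1_theta13OfThm1CCMW hγ)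
    (M₁_pos_theta13OfThm1CCMW F N j γ ε₀ ε₂₉ B₃ B₃' a₀ a₁) hadm

/-- **§2b ★★★ ROW P11 IN ITS OWN CURRENCY `BgProvisoΛ … (suppOfRecord₁₃SepCoP …) (UbgOfRecord₁₃CoP …)` AT K1's WITNESS OF RECORD `θ₁₅ᶜᶜᴹᵂ(j; γ)` ON EVERY WINDOW RUN FROM THE ᴮ SENTENCES — ANY GUARD MET ON
THE WINDOW PREFIXES, ANY BACKGROUND WITH `hbg` ∧ `hseam`, THE TRANSFER `hDat` DISPLAYED** (§2a through K0a's support adapter; the exact TYPE of `Provisos₁₃SepCoPH.bg`'s consequent at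
this witness with NO `PartCompat₁₃` antecedent, and of dag-n11-w1's `hbg(s)` binders).  The campaign re-keys of `…GaugeROfHcubeOmega` §6, `…GaugeRAtWitnessOfPowM` §3, `…GaugeGOfHcubeOmega` §5 ∕ §6b ∕ §6c at this witness are this theorem at
`(UbgMSCoPOfRecordB, lamDatum F, ubgMSCoPOfRecordB_dichotomy, UbgOfRecord₁₃CoP_succ)`.  CONDITIONAL; nothing of Bałaban asserted.
[cite: Balaban1988Convergent, (2.28) p.259, (2.18) p.257, Thm 1 p.262; Balaban1985Variational, (3),(6)–(7) p.278, Thm 1 (8)–(9) p.279, p.304 lines 1–2; Balaban1985RegularSpaces, (1.3)–(1.6) p.77; Balaban1984PropagatorsII, (2.3) p.224; Balaban1987RG1, (0.1) p.251, (1.12) p.262] -/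
theorem bgProvisoΛ_theta13OfThm1CCMW_of_thm1RegSepCoP7MGB_of_thm1GaugeGB_of_hseam_of_hjm (hγ0 : 0 < γ) (hγ : γ ≤ 1 / 2) (hjm : j + 1 ≤ F.m) (hε : 0 < ε₀) (hε' : 0 < ε₂₉) (hB : 0 ≤ B₃) (hB' : 0 ≤ B₃')
    (ha₀ : 0 < a₀) (ha₁ : 0 < a₁) {Adm : StepGuard F} {bd : BondDatum F} {Dat : TopData F N}
    (h15 : VariationalThm1RegSepCoP7MGB F N Adm bd Dat B₃ a₀ a₁) (h15G : VariationalThm1GaugeRegSepCoP7MGB F N (F.L ^ j) Adm bd Dat B₃ B₃' a₀ a₁)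
    (Ubg : (p : B12.RunParams) → (n : ℕ) → SeqOfRecord F (theta13OfThm1CCMW F N j γ ε₀ ε₂₉ B₃ B₃' a₀ a₁).ν (theta13OfThm1CCMW F N j γ ε₀ ε₂₉ B₃ B₃' a₀ a₁).τ9.M (gOfRecord₁₃ F N (theta13OfThm1CCMW F N j γ ε₀ ε₂₉ B₃ B₃' a₀ a₁) p) p.K n → BgMap F N p.K)
    (hbg : ∀ (p : B12.RunParams) (n : ℕ) (s : SeqOfRecord F (theta13OfThm1CCMW F N j γ ε₀ ε₂₉ B₃ B₃' a₀ a₁).ν (theta13OfThm1CCMW F N j γ ε₀ ε₂₉ B₃ B₃' a₀ a₁).τ9.M (gOfRecord₁₃ F N (theta13OfThm1CCMW F N j γ ε₀ ε₂₉ B₃ B₃' a₀ a₁) p) p.K n) (W : MSField (F.P p.K) (SU N)),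
      IsMinimizerB (avOfRecord F N p.K) (regMSCoPOfRecord F N (theta13OfThm1CCMW F N j γ ε₀ ε₂₉ B₃ B₃' a₀ a₁).ν p.K n s.Ω) (bd p.K n s.Ω) W (Ubg p n s W) ∨ Ubg p n s W = 1)
    (hseam : ∀ (p : B12.RunParams) (n : ℕ), UbgOfRecord₁₃CoP F N (theta13OfThm1CCMW F N j γ ε₀ ε₂₉ B₃ B₃' a₀ a₁) p (n + 1) = Ubg p (n + 1))
    (hadm : ∀ (p : B12.RunParams) (n : ℕ), n ≤ p.K → Step.InInterval (theta13OfThm1CCMW F N j γ ε₀ ε₂₉ B₃ B₃' a₀ a₁).γ n (gOfRecord₁₃ F N (theta13OfThm1CCMW F N j γ ε₀ ε₂₉ B₃ B₃' a₀ a₁) p) →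
      ∀ s : SeqOfRecord F (theta13OfThm1CCMW F N j γ ε₀ ε₂₉ B₃ B₃' a₀ a₁).ν (theta13OfThm1CCMW F N j γ ε₀ ε₂₉ B₃ B₃' a₀ a₁).τ9.M (gOfRecord₁₃ F N (theta13OfThm1CCMW F N j γ ε₀ ε₂₉ B₃ B₃' a₀ a₁) p) p.K n, Adm (theta13OfThm1CCMW F N j γ ε₀ ε₂₉ B₃ B₃' a₀ a₁).ν (theta13OfThm1CCMW F N j γ ε₀ ε₂₉ B₃ B₃' a₀ a₁).τ9.M (gOfRecord₁₃ F N (theta13OfThm1CCMW F N j γ ε₀ ε₂₉ B₃ B₃' a₀ a₁) p) p.K n s)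
    (hDat : ∀ (p : B12.RunParams) (n : ℕ) (s : SeqOfRecord F (theta13OfThm1CCMW F N j γ ε₀ ε₂₉ B₃ B₃' a₀ a₁).ν (theta13OfThm1CCMW F N j γ ε₀ ε₂₉ B₃ B₃' a₀ a₁).τ9.M (gOfRecord₁₃ F N (theta13OfThm1CCMW F N j γ ε₀ ε₂₉ B₃ B₃' a₀ a₁) p) p.K n) (δ : ℕ → ℝ) (W : MSField (F.P p.K) (SU N)),
      n ≤ p.K → Step.InInterval (theta13OfThm1CCMW F N j γ ε₀ ε₂₉ B₃ B₃' a₀ a₁).γ n (gOfRecord₁₃ F N (theta13OfThm1CCMW F N j γ ε₀ ε₂₉ B₃ B₃' a₀ a₁) p) →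
      Sect2.DataSmall7PTop (avOfRecord F N p.K) s.Ω (suppDomOfRecord F (theta13OfThm1CCMW F N j γ ε₀ ε₂₉ B₃ B₃' a₀ a₁).ν p.K s.Ω) n δ W → Dat p.K s.Ω (suppDomOfRecord F (theta13OfThm1CCMW F N j γ ε₀ ε₂₉ B₃ B₃' a₀ a₁).ν p.K s.Ω) n δ W)
    (hcomp : ∀ (p : B12.RunParams) (n : ℕ), n ≤ p.K → Step.InInterval (theta13OfThm1CCMW F N j γ ε₀ ε₂₉ B₃ B₃' a₀ a₁).γ n (gOfRecord₁₃ F N (theta13OfThm1CCMW F N j γ ε₀ ε₂₉ B₃ B₃' a₀ a₁) p) → ∀ m, m < n →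
      (theta13OfThm1CCMW F N j γ ε₀ ε₂₉ B₃ B₃' a₀ a₁).s2.cR * epsOfRecord (theta13OfThm1CCMW F N j γ ε₀ ε₂₉ B₃ B₃' a₀ a₁).ν (gOfRecord₁₃ F N (theta13OfThm1CCMW F N j γ ε₀ ε₂₉ B₃ B₃' a₀ a₁) p) m ≤ 2 * ((theta13OfThm1CCMW F N j γ ε₀ ε₂₉ B₃ B₃' a₀ a₁).s2.cR * epsOfRecord (theta13OfThm1CCMW F N j γ ε₀ ε₂₉ B₃ B₃' a₀ a₁).ν (gOfRecord₁₃ F N (theta13OfThm1CCMW F N j γ ε₀ ε₂₉ B₃ B₃' a₀ a₁) p) (m + 1)))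
    (hcompRev : ∀ (p : B12.RunParams) (n : ℕ), n ≤ p.K → Step.InInterval (theta13OfThm1CCMW F N j γ ε₀ ε₂₉ B₃ B₃' a₀ a₁).γ n (gOfRecord₁₃ F N (theta13OfThm1CCMW F N j γ ε₀ ε₂₉ B₃ B₃' a₀ a₁) p) → ∀ m, m < n →
      (theta13OfThm1CCMW F N j γ ε₀ ε₂₉ B₃ B₃' a₀ a₁).s2.cR * epsOfRecord (theta13OfThm1CCMW F N j γ ε₀ ε₂₉ B₃ B₃' a₀ a₁).ν (gOfRecord₁₃ F N (theta13OfThm1CCMW F N j γ ε₀ ε₂₉ B₃ B₃' a₀ a₁) p) (m + 1) ≤ 2 * ((theta13OfThm1CCMW F N j γ ε₀ ε₂₉ B₃ B₃' a₀ a₁).s2.cR * epsOfRecord (theta13OfThm1CCMW F N j γ ε₀ ε₂₉ B₃ B₃' a₀ a₁).ν (gOfRecord₁₃ F N (theta13OfThm1CCMW F N j γ ε₀ ε₂₉ B₃ B₃' a₀ a₁) p) m)) :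
    ∀ (p : B12.RunParams) (n : ℕ), n ≤ p.K → Step.InInterval (theta13OfThm1CCMW F N j γ ε₀ ε₂₉ B₃ B₃' a₀ a₁).γ n (gOfRecord₁₃ F N (theta13OfThm1CCMW F N j γ ε₀ ε₂₉ B₃ B₃' a₀ a₁) p) →
      BgProvisoΛ F N p.K (settingOfRecord₁₃ F N (theta13OfThm1CCMW F N j γ ε₀ ε₂₉ B₃ B₃' a₀ a₁) p) ((theta13OfThm1CCMW F N j γ ε₀ ε₂₉ B₃ B₃' a₀ a₁).Rz p.K) (theta13OfThm1CCMW F N j γ ε₀ ε₂₉ B₃ B₃' a₀ a₁).τ9.M n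
        (suppOfRecord₁₃SepCoP F N (theta13OfThm1CCMW F N j γ ε₀ ε₂₉ B₃ B₃' a₀ a₁) p n) (UbgOfRecord₁₃CoP F N (theta13OfThm1CCMW F N j γ ε₀ ε₂₉ B₃ B₃' a₀ a₁) p n) :=
  bgProvisoΛ_of_thm1RegSepCoP7MGB_of_thm1GaugeGB_of_hseam_of_powM (theta13OfThm1CCMW F N j γ ε₀ ε₂₉ B₃ B₃' a₀ a₁) (admissible_theta13OfThm1CCMW_of_le_half F N hγ0 hγ hε hε' hB hB' ha₀ ha₁) rfl
    h15 h15G Ubg hbg hseam (hnum_theta13OfThm1CCMW hγ hB hB' ha₀ ha₁) εreg_le_theta13OfThm1CCMW hcomp hcompRev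
    (hBα_theta13OfThm1CCMW hγ hB hB' ha₀.le ha₁.le) (htI_theta13OfThm1CCMW hγ hB hB' ha₀.le ha₁.le) (htMS_theta13OfThm1CCMW hγ hB hB' ha₀.le ha₁.le)
    (hsN_theta13OfThm1CCMW F N γ ε₀ ε₂₉ B₃ B₃' a₀ a₁ hjm) (theta13OfThm1CCMW_τ9_M F N j γ ε₀ ε₂₉ B₃ B₃' a₀ a₁) (hC1_theta13OfThm1CCMW hγ)
    (M₁_pos_theta13OfThm1CCMW F N j γ ε₀ ε₂₉ B₃ B₃' a₀ a₁) hadm hDat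

end WitnessCCMW

/-! ## §3  At THE z-WITNESS `θ₁₅ᶜᶜᴹᵂᶻ(j; γ; Efl, logz)` — non-wrapping families `j + 1 ≤ F.m`, EVERY window run, NO run guard; the letters of `Record13LettersOfThm1CCMWZ` -/

section WitnessCCMWZ

variable {j : ℕ} {γ ε₀ ε₂₉ B₃ B₃' a₀ a₁ : ℝ} {Efl logz : B12.RunParams → ℕ → ℝ}

/-- **§3a ★★★ THE (7)-GUARDED SEPARATED ROW P11 BODY AT THE z-WITNESS `θ₁₅ᶜᶜᴹᵂᶻ(j; γ; Efl, logz)` ON EVERY WINDOW RUN FROM THE ᴮ SENTENCES — ANY GUARD `Adm` MET ON THE WINDOW PREFIXES, ANY BACKGROUND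
`(Ubg, bd)` WITH `hbg` ∧ `hseam`, data antecedent `Dat …`** — §1a at `θ := theta13OfThm1CCMWZ F N j γ ε₀ ε₂₉ B₃ B₃' a₀ a₁ Efl logz` on a non-wrapping family `j + 1 ≤ F.m`: admissibility from `0 < γ ≤ ½` and the six signs, `Rz` by
`rfl`, the numeric rows, `τ9.M = L^j`, (C1) on the window runs, the no-wrap letter from `hjm`, `0 < M₁` — all BY NAME from `Record13LettersOfThm1CCMWZ`.  The campaign re-keys of `…BgRowAtZWitnessOfPowM` §1a ∕ §2a ∕ §3a at this witness
are this theorem at `(Ubg, bd, hbg, hseam) := (UbgMSCoPOfRecordB, lamDatum F, ubgMSCoPOfRecordB_dichotomy, UbgOfRecord₁₃CoP_succ)` (R road: `Adm := floorGuard F c`, `hadm` from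
`c ≤ L^j = ν.M₁`).  CONDITIONAL; nothing of Bałaban asserted.
[cite: Balaban1985Variational, (6)–(7) p.278, Thm 1 (8)–(9) p.279, (144)–(152) pp.300–301, Prop. 8 p.304, p.304 lines 1–2; Balaban1985RegularSpaces, (1.3)–(1.9) p.77; Balaban1984PropagatorsII, (2.3) p.224; Balaban1988Convergent, Thm 1 p.262, (2.1) p.254, (2.4)–(2.8) pp.255–256, (2.12)–(2.13) pp.256–257, (2.28) p.259, p.257; Balaban1987RG1, (0.1) p.251, Thm 1 p.259, (1.12) p.262; Balaban1989LargeFieldI, (0.3) p.176] -/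
theorem bgSepCoPAt_theta13OfThm1CCMWZ_of_thm1RegSepCoP7MGB_of_thm1GaugeGB_of_hseam_of_hjm (hγ0 : 0 < γ) (hγ : γ ≤ 1 / 2) (hjm : j + 1 ≤ F.m) (hε : 0 < ε₀) (hε' : 0 < ε₂₉) (hB : 0 ≤ B₃) (hB' : 0 ≤ B₃')
    (ha₀ : 0 < a₀) (ha₁ : 0 < a₁) {Adm : StepGuard F} {bd : BondDatum F} {Dat : TopData F N}
    (h15 : VariationalThm1RegSepCoP7MGB F N Adm bd Dat B₃ a₀ a₁) (h15G : VariationalThm1GaugeRegSepCoP7MGB F N (F.L ^ j) Adm bd Dat B₃ B₃' a₀ a₁)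
    (Ubg : (p : B12.RunParams) → (n : ℕ) → SeqOfRecord F (theta13OfThm1CCMWZ F N j γ ε₀ ε₂₉ B₃ B₃' a₀ a₁ Efl logz).ν (theta13OfThm1CCMWZ F N j γ ε₀ ε₂₉ B₃ B₃' a₀ a₁ Efl logz).τ9.M (gOfRecord₁₃ F N (theta13OfThm1CCMWZ F N j γ ε₀ ε₂₉ B₃ B₃' a₀ a₁ Efl logz) p) p.K n → BgMap F N p.K)
    (hbg : ∀ (p : B12.RunParams) (n : ℕ) (s : SeqOfRecord F (theta13OfThm1CCMWZ F N j γ ε₀ ε₂₉ B₃ B₃' a₀ a₁ Efl logz).ν (theta13OfThm1CCMWZ F N j γ ε₀ ε₂₉ B₃ B₃' a₀ a₁ Efl logz).τ9.M (gOfRecord₁₃ F N (theta13OfThm1CCMWZ F N j γ ε₀ ε₂₉ B₃ B₃' a₀ a₁ Efl logz) p) p.K n) (W : MSField (F.P p.K) (SU N)),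
      IsMinimizerB (avOfRecord F N p.K) (regMSCoPOfRecord F N (theta13OfThm1CCMWZ F N j γ ε₀ ε₂₉ B₃ B₃' a₀ a₁ Efl logz).ν p.K n s.Ω) (bd p.K n s.Ω) W (Ubg p n s W) ∨ Ubg p n s W = 1)
    (hseam : ∀ (p : B12.RunParams) (n : ℕ), UbgOfRecord₁₃CoP F N (theta13OfThm1CCMWZ F N j γ ε₀ ε₂₉ B₃ B₃' a₀ a₁ Efl logz) p (n + 1) = Ubg p (n + 1))
    (hadm : ∀ (p : B12.RunParams) (n : ℕ), n ≤ p.K → Step.InInterval (theta13OfThm1CCMWZ F N j γ ε₀ ε₂₉ B₃ B₃' a₀ a₁ Efl logz).γ n (gOfRecord₁₃ F N (theta13OfThm1CCMWZ F N j γ ε₀ ε₂₉ B₃ B₃' a₀ a₁ Efl logz) p) →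
      ∀ s : SeqOfRecord F (theta13OfThm1CCMWZ F N j γ ε₀ ε₂₉ B₃ B₃' a₀ a₁ Efl logz).ν (theta13OfThm1CCMWZ F N j γ ε₀ ε₂₉ B₃ B₃' a₀ a₁ Efl logz).τ9.M (gOfRecord₁₃ F N (theta13OfThm1CCMWZ F N j γ ε₀ ε₂₉ B₃ B₃' a₀ a₁ Efl logz) p) p.K n, Adm (theta13OfThm1CCMWZ F N j γ ε₀ ε₂₉ B₃ B₃' a₀ a₁ Efl logz).ν (theta13OfThm1CCMWZ F N j γ ε₀ ε₂₉ B₃ B₃' a₀ a₁ Efl logz).τ9.M (gOfRecord₁₃ F N (theta13OfThm1CCMWZ F N j γ ε₀ ε₂₉ B₃ B₃' a₀ a₁ Efl logz) p) p.K n s)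
    (hcomp : ∀ (p : B12.RunParams) (n : ℕ), n ≤ p.K → Step.InInterval (theta13OfThm1CCMWZ F N j γ ε₀ ε₂₉ B₃ B₃' a₀ a₁ Efl logz).γ n (gOfRecord₁₃ F N (theta13OfThm1CCMWZ F N j γ ε₀ ε₂₉ B₃ B₃' a₀ a₁ Efl logz) p) → ∀ m, m < n →
      (theta13OfThm1CCMWZ F N j γ ε₀ ε₂₉ B₃ B₃' a₀ a₁ Efl logz).s2.cR * epsOfRecord (theta13OfThm1CCMWZ F N j γ ε₀ ε₂₉ B₃ B₃' a₀ a₁ Efl logz).ν (gOfRecord₁₃ F N (theta13OfThm1CCMWZ F N j γ ε₀ ε₂₉ B₃ B₃' a₀ a₁ Efl logz) p) m ≤ 2 * ((theta13OfThm1CCMWZ F N j γ ε₀ ε₂₉ B₃ B₃' a₀ a₁ Efl logz).s2.cR * epsOfRecord (theta13OfThm1CCMWZ F N j γ ε₀ ε₂₉ B₃ B₃' a₀ a₁ Efl logz).ν (gOfRecord₁₃ F N (theta13OfThm1CCMWZ F N j γ ε₀ ε₂₉ B₃ B₃' a₀ a₁ Efl logz) p) (m + 1)))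
    (hcompRev : ∀ (p : B12.RunParams) (n : ℕ), n ≤ p.K → Step.InInterval (theta13OfThm1CCMWZ F N j γ ε₀ ε₂₉ B₃ B₃' a₀ a₁ Efl logz).γ n (gOfRecord₁₃ F N (theta13OfThm1CCMWZ F N j γ ε₀ ε₂₉ B₃ B₃' a₀ a₁ Efl logz) p) → ∀ m, m < n →
      (theta13OfThm1CCMWZ F N j γ ε₀ ε₂₉ B₃ B₃' a₀ a₁ Efl logz).s2.cR * epsOfRecord (theta13OfThm1CCMWZ F N j γ ε₀ ε₂₉ B₃ B₃' a₀ a₁ Efl logz).ν (gOfRecord₁₃ F N (theta13OfThm1CCMWZ F N j γ ε₀ ε₂₉ B₃ B₃' a₀ a₁ Efl logz) p) (m + 1) ≤ 2 * ((theta13OfThm1CCMWZ F N j γ ε₀ ε₂₉ B₃ B₃' a₀ a₁ Efl logz).s2.cR * epsOfRecord (theta13OfThm1CCMWZ F N j γ ε₀ ε₂₉ B₃ B₃' a₀ a₁ Efl logz).ν (gOfRecord₁₃ F N (theta13OfThm1CCMWZ F N j γ ε₀ ε₂₉ B₃ B₃' a₀ a₁ Efl logz) p) m)) :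
    ∀ (p : B12.RunParams) (n : ℕ), n ≤ p.K → Step.InInterval (theta13OfThm1CCMWZ F N j γ ε₀ ε₂₉ B₃ B₃' a₀ a₁ Efl logz).γ n (gOfRecord₁₃ F N (theta13OfThm1CCMWZ F N j γ ε₀ ε₂₉ B₃ B₃' a₀ a₁ Efl logz) p) →
      ∀ s : SeqOfRecord F (theta13OfThm1CCMWZ F N j γ ε₀ ε₂₉ B₃ B₃' a₀ a₁ Efl logz).ν (theta13OfThm1CCMWZ F N j γ ε₀ ε₂₉ B₃ B₃' a₀ a₁ Efl logz).τ9.M (gOfRecord₁₃ F N (theta13OfThm1CCMWZ F N j γ ε₀ ε₂₉ B₃ B₃' a₀ a₁ Efl logz) p) p.K n, Sect2.SeqSeparated (theta13OfThm1CCMWZ F N j γ ε₀ ε₂₉ B₃ B₃' a₀ a₁ Efl logz).ν.M₁ s →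
      ∀ W : MSField (F.P p.K) (SU N), W ∈ suppOfRecord₁₃P F N (theta13OfThm1CCMWZ F N j γ ε₀ ε₂₉ B₃ B₃' a₀ a₁ Efl logz) p n s →
      Dat p.K s.Ω (suppDomOfRecord F (theta13OfThm1CCMWZ F N j γ ε₀ ε₂₉ B₃ B₃' a₀ a₁ Efl logz).ν p.K s.Ω) n (fun j' => (theta13OfThm1CCMWZ F N j γ ε₀ ε₂₉ B₃ B₃' a₀ a₁ Efl logz).s2.cR * epsOfRecord (theta13OfThm1CCMWZ F N j γ ε₀ ε₂₉ B₃ B₃' a₀ a₁ Efl logz).ν (gOfRecord₁₃ F N (theta13OfThm1CCMWZ F N j γ ε₀ ε₂₉ B₃ B₃' a₀ a₁ Efl logz) p) j') W →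
      ∀ j', 1 ≤ j' → j' ≤ n → ∀ X : (Sect2.domSys (F.P p.K) (theta13OfThm1CCMWZ F N j γ ε₀ ε₂₉ B₃ B₃' a₀ a₁ Efl logz).τ9.M j').Dom,
      (Sect2.domSites (F.P p.K) (theta13OfThm1CCMWZ F N j γ ε₀ ε₂₉ B₃ B₃' a₀ a₁ Efl logz).τ9.M j' X ⊆ s.Λ j' →
        Sect2.ofBackgroundC (settingOfRecord₁₃ F N (theta13OfThm1CCMWZ F N j γ ε₀ ε₂₉ B₃ B₃' a₀ a₁ Efl logz) p).ι (UbgOfRecord₁₃CoP F N (theta13OfThm1CCMWZ F N j γ ε₀ ε₂₉ B₃ B₃' a₀ a₁ Efl logz) p n s W) ∈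
          Sect2.spaceI (settingOfRecord₁₃ F N (theta13OfThm1CCMWZ F N j γ ε₀ ε₂₉ B₃ B₃' a₀ a₁ Efl logz) p) ((theta13OfThm1CCMWZ F N j γ ε₀ ε₂₉ B₃ B₃' a₀ a₁ Efl logz).Rz p.K) (theta13OfThm1CCMWZ F N j γ ε₀ ε₂₉ B₃ B₃' a₀ a₁ Efl logz).τ9.M j' (Sect2.domSites (F.P p.K) (theta13OfThm1CCMWZ F N j γ ε₀ ε₂₉ B₃ B₃' a₀ a₁ Efl logz).τ9.M j' X)
            ((settingOfRecord₁₃ F N (theta13OfThm1CCMWZ F N j γ ε₀ ε₂₉ B₃ B₃' a₀ a₁ Efl logz) p).lf.alpha0 ((settingOfRecord₁₃ F N (theta13OfThm1CCMWZ F N j γ ε₀ ε₂₉ B₃ B₃' a₀ a₁ Efl logz) p).flow.g j')) ((settingOfRecord₁₃ F N (theta13OfThm1CCMWZ F N j γ ε₀ ε₂₉ B₃ B₃' a₀ a₁ Efl logz) p).lf.alpha1 ((settingOfRecord₁₃ F N (theta13OfThm1CCMWZ F N j γ ε₀ ε₂₉ B₃ B₃' a₀ a₁ Efl logz) p).flow.g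 j'))) ∧
      (Sect2.admB (F.P p.K) (theta13OfThm1CCMWZ F N j γ ε₀ ε₂₉ B₃ B₃' a₀ a₁ Efl logz).ν (theta13OfThm1CCMWZ F N j γ ε₀ ε₂₉ B₃ B₃' a₀ a₁ Efl logz).τ9.M (gOfRecord₁₃ F N (theta13OfThm1CCMWZ F N j γ ε₀ ε₂₉ B₃ B₃' a₀ a₁ Efl logz) p) s.Ω s.Λ j' (Sect2.domSites (F.P p.K) (theta13OfThm1CCMWZ F N j γ ε₀ ε₂₉ B₃ B₃' a₀ a₁ Efl logz).τ9.M j' X) = true →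
        Sect2.ofBackgroundC (settingOfRecord₁₃ F N (theta13OfThm1CCMWZ F N j γ ε₀ ε₂₉ B₃ B₃' a₀ a₁ Efl logz) p).ι (UbgOfRecord₁₃CoP F N (theta13OfThm1CCMWZ F N j γ ε₀ ε₂₉ B₃ B₃' a₀ a₁ Efl logz) p n s W) ∈
          Sect2.spaceMS (settingOfRecord₁₃ F N (theta13OfThm1CCMWZ F N j γ ε₀ ε₂₉ B₃ B₃' a₀ a₁ Efl logz) p) ((theta13OfThm1CCMWZ F N j γ ε₀ ε₂₉ B₃ B₃' a₀ a₁ Efl logz).Rz p.K) (theta13OfThm1CCMWZ F N j γ ε₀ ε₂₉ B₃ B₃' a₀ a₁ Efl logz).τ9.M j' (Sect2.domSites (F.P p.K) (theta13OfThm1CCMWZ F N j γ ε₀ ε₂₉ B₃ B₃' a₀ a₁ Efl logz).τ9.M j' X) s.Ω) :=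
  bgSepCoPAt_of_thm1RegSepCoP7MGB_of_thm1GaugeGB_of_hseam_of_powM (theta13OfThm1CCMWZ F N j γ ε₀ ε₂₉ B₃ B₃' a₀ a₁ Efl logz) (admissible_theta13OfThm1CCMWZ_of_le_half F N Efl logz hγ0 hγ hε hε' hB hB' ha₀ ha₁) rfl
    h15 h15G Ubg hbg hseam (hnum_theta13OfThm1CCMWZ hγ hB hB' ha₀ ha₁) εreg_le_theta13OfThm1CCMWZ hcomp hcompRev
    (hBα_theta13OfThm1CCMWZ hγ hB hB' ha₀.le ha₁.le) (htI_theta13OfThm1CCMWZ hγ hB hB' ha₀.le ha₁.le) (htMS_theta13OfThm1CCMWZ hγ hB hB' ha₀.le ha₁.le)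
    (hsN_theta13OfThm1CCMWZ F N γ ε₀ ε₂₉ B₃ B₃' a₀ a₁ Efl logz hjm) (theta13OfThm1CCMWZ_τ9_M F N j γ ε₀ ε₂₉ B₃ B₃' a₀ a₁ Efl logz) (hC1_theta13OfThm1CCMWZ hγ)
    (M₁_pos_theta13OfThm1CCMWZ F N j γ ε₀ ε₂₉ B₃ B₃' a₀ a₁ Efl logz) hadm

/-- **§3b ★★★ ROW P11 IN ITS OWN CURRENCY `BgProvisoΛ … (suppOfRecord₁₃SepCoP …) (UbgOfRecord₁₃CoP …)` AT THE z-WITNESS `θ₁₅ᶜᶜᴹᵂᶻ(j; γ; Efl, logz)` ON EVERY WINDOW RUN FROM THE ᴮ SENTENCES — ANY GUARD MET ON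
THE WINDOW PREFIXES, ANY BACKGROUND WITH `hbg` ∧ `hseam`, THE TRANSFER `hDat` DISPLAYED** (§3a through K0a's support adapter; the exact TYPE of `Provisos₁₃SepCoPH.bg`'s consequent at
this witness with NO `PartCompat₁₃` antecedent, and of dag-n11-w1's `hbg(s)` binders).  The campaign re-keys of `…BgRowAtZWitnessOfPowM` §1b ∕ §2b ∕ §3b ∕ §4 at this witness are this theorem at
`(UbgMSCoPOfRecordB, lamDatum F, ubgMSCoPOfRecordB_dichotomy, UbgOfRecord₁₃CoP_succ)`.  CONDITIONAL; nothing of Bałaban asserted.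
[cite: Balaban1988Convergent, (2.28) p.259, (2.18) p.257, Thm 1 p.262; Balaban1985Variational, (3),(6)–(7) p.278, Thm 1 (8)–(9) p.279, p.304 lines 1–2; Balaban1985RegularSpaces, (1.3)–(1.6) p.77; Balaban1984PropagatorsII, (2.3) p.224; Balaban1987RG1, (0.1) p.251, (1.12) p.262; Balaban1989LargeFieldI, (0.3) p.176] -/
theorem bgProvisoΛ_theta13OfThm1CCMWZ_of_thm1RegSepCoP7MGB_of_thm1GaugeGB_of_hseam_of_hjm (hγ0 : 0 < γ) (hγ : γ ≤ 1 / 2) (hjm : j + 1 ≤ F.m) (hε : 0 < ε₀) (hε' : 0 < ε₂₉) (hB : 0 ≤ B₃) (hB' : 0 ≤ B₃')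
    (ha₀ : 0 < a₀) (ha₁ : 0 < a₁) {Adm : StepGuard F} {bd : BondDatum F} {Dat : TopData F N}
    (h15 : VariationalThm1RegSepCoP7MGB F N Adm bd Dat B₃ a₀ a₁) (h15G : VariationalThm1GaugeRegSepCoP7MGB F N (F.L ^ j) Adm bd Dat B₃ B₃' a₀ a₁)
    (Ubg : (p : B12.RunParams) → (n : ℕ) → SeqOfRecord F (theta13OfThm1CCMWZ F N j γ ε₀ ε₂₉ B₃ B₃' a₀ a₁ Efl logz).ν (theta13OfThm1CCMWZ F N j γ ε₀ ε₂₉ B₃ B₃' a₀ a₁ Efl logz).τ9.M (gOfRecord₁₃ F N (theta13OfThm1CCMWZ F N j γ ε₀ ε₂₉ B₃ B₃' a₀ a₁ Efl logz) p) p.K n → BgMap F N p.K)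
    (hbg : ∀ (p : B12.RunParams) (n : ℕ) (s : SeqOfRecord F (theta13OfThm1CCMWZ F N j γ ε₀ ε₂₉ B₃ B₃' a₀ a₁ Efl logz).ν (theta13OfThm1CCMWZ F N j γ ε₀ ε₂₉ B₃ B₃' a₀ a₁ Efl logz).τ9.M (gOfRecord₁₃ F N (theta13OfThm1CCMWZ F N j γ ε₀ ε₂₉ B₃ B₃' a₀ a₁ Efl logz) p) p.K n) (W : MSField (F.P p.K) (SU N)),
      IsMinimizerB (avOfRecord F N p.K) (regMSCoPOfRecord F N (theta13OfThm1CCMWZ F N j γ ε₀ ε₂₉ B₃ B₃' a₀ a₁ Efl logz).ν p.K n s.Ω) (bd p.K n s.Ω) W (Ubg p n s W) ∨ Ubg p n s W = 1)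
    (hseam : ∀ (p : B12.RunParams) (n : ℕ), UbgOfRecord₁₃CoP F N (theta13OfThm1CCMWZ F N j γ ε₀ ε₂₉ B₃ B₃' a₀ a₁ Efl logz) p (n + 1) = Ubg p (n + 1))
    (hadm : ∀ (p : B12.RunParams) (n : ℕ), n ≤ p.K → Step.InInterval (theta13OfThm1CCMWZ F N j γ ε₀ ε₂₉ B₃ B₃' a₀ a₁ Efl logz).γ n (gOfRecord₁₃ F N (theta13OfThm1CCMWZ F N j γ ε₀ ε₂₉ B₃ B₃' a₀ a₁ Efl logz) p) →
      ∀ s : SeqOfRecord F (theta13OfThm1CCMWZ F N j γ ε₀ ε₂₉ B₃ B₃' a₀ a₁ Efl logz).ν (theta13OfThm1CCMWZ F N j γ ε₀ ε₂₉ B₃ B₃' a₀ a₁ Efl logz).τ9.M (gOfRecord₁₃ F N (theta13OfThm1CCMWZ F N j γ ε₀ ε₂₉ B₃ B₃' a₀ a₁ Efl logz) p) p.K n, Adm (theta13OfThm1CCMWZ F N j γ ε₀ ε₂₉ B₃ B₃' a₀ a₁ Efl logz).ν (theta13OfThm1CCMWZ F N j γ ε₀ ε₂₉ B₃ B₃'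 a₀ a₁ Efl logz).τ9.M (gOfRecord₁₃ F N (theta13OfThm1CCMWZ F N j γ ε₀ ε₂₉ B₃ B₃' a₀ a₁ Efl logz) p) p.K n s)
    (hDat : ∀ (p : B12.RunParams) (n : ℕ) (s : SeqOfRecord F (theta13OfThm1CCMWZ F N j γ ε₀ ε₂₉ B₃ B₃' a₀ a₁ Efl logz).ν (theta13OfThm1CCMWZ F N j γ ε₀ ε₂₉ B₃ B₃' a₀ a₁ Efl logz).τ9.M (gOfRecord₁₃ F N (theta13OfThm1CCMWZ F N j γ ε₀ ε₂₉ B₃ B₃' a₀ a₁ Efl logz) p) p.K n) (δ : ℕ → ℝ) (W : MSField (F.P p.K) (SU N)),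
      n ≤ p.K → Step.InInterval (theta13OfThm1CCMWZ F N j γ ε₀ ε₂₉ B₃ B₃' a₀ a₁ Efl logz).γ n (gOfRecord₁₃ F N (theta13OfThm1CCMWZ F N j γ ε₀ ε₂₉ B₃ B₃' a₀ a₁ Efl logz) p) →
      Sect2.DataSmall7PTop (avOfRecord F N p.K) s.Ω (suppDomOfRecord F (theta13OfThm1CCMWZ F N j γ ε₀ ε₂₉ B₃ B₃' a₀ a₁ Efl logz).ν p.K s.Ω) n δ W → Dat p.K s.Ω (suppDomOfRecord F (theta13OfThm1CCMWZ F N j γ ε₀ ε₂₉ B₃ B₃' a₀ a₁ Efl logz).ν p.K s.Ω) n δ W)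
    (hcomp : ∀ (p : B12.RunParams) (n : ℕ), n ≤ p.K → Step.InInterval (theta13OfThm1CCMWZ F N j γ ε₀ ε₂₉ B₃ B₃' a₀ a₁ Efl logz).γ n (gOfRecord₁₃ F N (theta13OfThm1CCMWZ F N j γ ε₀ ε₂₉ B₃ B₃' a₀ a₁ Efl logz) p) → ∀ m, m < n →
      (theta13OfThm1CCMWZ F N j γ ε₀ ε₂₉ B₃ B₃' a₀ a₁ Efl logz).s2.cR * epsOfRecord (theta13OfThm1CCMWZ F N j γ ε₀ ε₂₉ B₃ B₃' a₀ a₁ Efl logz).ν (gOfRecord₁₃ F N (theta13OfThm1CCMWZ F N j γ ε₀ ε₂₉ B₃ B₃' a₀ a₁ Efl logz) p) m ≤ 2 * ((theta13OfThm1CCMWZ F N j γ ε₀ ε₂₉ B₃ B₃' a₀ a₁ Efl logz).s2.cR * epsOfRecord (theta13OfThm1CCMWZ F N j γ ε₀ ε₂₉ B₃ B₃' a₀ a₁ Efl logz).ν (gOfRecord₁₃ F N (theta13OfThm1CCMWZ F N j γ ε₀ ε₂₉ B₃ B₃' a₀ a₁ Efl logz) p) (m + 1)))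
    (hcompRev : ∀ (p : B12.RunParams) (n : ℕ), n ≤ p.K → Step.InInterval (theta13OfThm1CCMWZ F N j γ ε₀ ε₂₉ B₃ B₃' a₀ a₁ Efl logz).γ n (gOfRecord₁₃ F N (theta13OfThm1CCMWZ F N j γ ε₀ ε₂₉ B₃ B₃' a₀ a₁ Efl logz) p) → ∀ m, m < n →
      (theta13OfThm1CCMWZ F N j γ ε₀ ε₂₉ B₃ B₃' a₀ a₁ Efl logz).s2.cR * epsOfRecord (theta13OfThm1CCMWZ F N j γ ε₀ ε₂₉ B₃ B₃' a₀ a₁ Efl logz).ν (gOfRecord₁₃ F N (theta13OfThm1CCMWZ F N j γ ε₀ ε₂₉ B₃ B₃' a₀ a₁ Efl logz) p) (m + 1) ≤ 2 * ((theta13OfThm1CCMWZ F N j γ ε₀ ε₂₉ B₃ B₃' a₀ a₁ Efl logz).s2.cR * epsOfRecord (theta13OfThm1CCMWZ F N j γ ε₀ ε₂₉ B₃ B₃' a₀ a₁ Efl logz).ν (gOfRecord₁₃ F N (theta13OfThm1CCMWZ F N j γ ε₀ ε₂₉ B₃ B₃' a₀ a₁ Efl logz) p) m)) :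
    ∀ (p : B12.RunParams) (n : ℕ), n ≤ p.K → Step.InInterval (theta13OfThm1CCMWZ F N j γ ε₀ ε₂₉ B₃ B₃' a₀ a₁ Efl logz).γ n (gOfRecord₁₃ F N (theta13OfThm1CCMWZ F N j γ ε₀ ε₂₉ B₃ B₃' a₀ a₁ Efl logz) p) →
      BgProvisoΛ F N p.K (settingOfRecord₁₃ F N (theta13OfThm1CCMWZ F N j γ ε₀ ε₂₉ B₃ B₃' a₀ a₁ Efl logz) p) ((theta13OfThm1CCMWZ F N j γ ε₀ ε₂₉ B₃ B₃' a₀ a₁ Efl logz).Rz p.K) (theta13OfThm1CCMWZ F N j γ ε₀ ε₂₉ B₃ B₃' a₀ a₁ Efl logz).τ9.M n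
        (suppOfRecord₁₃SepCoP F N (theta13OfThm1CCMWZ F N j γ ε₀ ε₂₉ B₃ B₃' a₀ a₁ Efl logz) p n) (UbgOfRecord₁₃CoP F N (theta13OfThm1CCMWZ F N j γ ε₀ ε₂₉ B₃ B₃' a₀ a₁ Efl logz) p n) :=
  bgProvisoΛ_of_thm1RegSepCoP7MGB_of_thm1GaugeGB_of_hseam_of_powM (theta13OfThm1CCMWZ F N j γ ε₀ ε₂₉ B₃ B₃' a₀ a₁ Efl logz) (admissible_theta13OfThm1CCMWZ_of_le_half F N Efl logz hγ0 hγ hε hε' hB hB' ha₀ ha₁) rfl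
    h15 h15G Ubg hbg hseam (hnum_theta13OfThm1CCMWZ hγ hB hB' ha₀ ha₁) εreg_le_theta13OfThm1CCMWZ hcomp hcompRev
    (hBα_theta13OfThm1CCMWZ hγ hB hB' ha₀.le ha₁.le) (htI_theta13OfThm1CCMWZ hγ hB hB' ha₀.le ha₁.le) (htMS_theta13OfThm1CCMWZ hγ hB hB' ha₀.le ha₁.le)
    (hsN_theta13OfThm1CCMWZ F N γ ε₀ ε₂₉ B₃ B₃' a₀ a₁ Efl logz hjm) (theta13OfThm1CCMWZ_τ9_M F N j γ ε₀ ε₂₉ B₃ B₃' a₀ a₁ Efl logz) (hC1_theta13OfThm1CCMWZ hγ)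
    (M₁_pos_theta13OfThm1CCMWZ F N j γ ε₀ ε₂₉ B₃ B₃' a₀ a₁ Efl logz) hadm hDat

end WitnessCCMWZ

end Summit.QuantumFields.YangMills.Theorems.BalabanUVNodesN11BgRowGaugeSocketsGB

end
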